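import Summits.QuantumFields.BalabanUV.T4Continuum.Support.VariationalColourTaxiTowerCentredEnd
import Summits.QuantumFields.BalabanUV.T4Continuum.Support.VariationalColourTaxiTowerProjGRegular

/-!
# T⁴ programme, spine node NE2 (U1a), lane P2 — THE VECTOR END AT BAŁABAN's TAXI DATA WITH (ONE-min) DISCHARGED AND (GF3) SUPPLIED: EXISTENCE OF THE TOWER LIMIT
# for Bałaban's covariant projected gauge functional ⇐ the plaquette class + the REGULAR PRESENTATION + the DECAY OF AN EXPLICIT SEQUENCE (item «ONE-MIN AT TAXI DATA —
# THE COMPOSITE-FIBRE ↔ TAXI-FRAME BRIDGE», file 9 = file 8 ∘ part 7; model level; cell `pub-balaban`)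

NE2 formalisation swarm `b2b-balaban-t4-ne2-formalise-*`, leaf prover 04 GEN 7 (`prover-b2b-balaban-t4-ne2-formalise-leaf-04-g7-0`); register row «P2-sup» of
`t4/formal/NE2/LEAVES.md`; journal CLAIMS.log INTENT 2026-08-20 l.21025, file 8 LANDED l.23173.  Composition BY NAME, exactly the pattern of part 7's
`effV_tendsto_taxiTower_projG_regular_of_class` (p232805, gen 6) over part 6: file 8's `effV_tendsto_taxiTower_projG_centred` (p240368) with its displayed uniform
(GF3) `hGdiv` fed by part 7's `hGdiv_projG_nestLv_regular` (constants `C_D = 36d(d+1)Cst_d(1)+8`, `C_D′ = 24d(d+1)Cst_d(1)+4`, uniform in `k`), a plaquette class sequence of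
the level bond fields taken from part 4's `taxiClassPackage`.  Nothing defined; one `exact`.

THE STATEMENT ([folklore]; `E = ℂ`).  **`effV_tendsto_taxiTower_projG_centred_regular`**: `2 ≤ L`, `1 ≤ d`, `1 < M_μ`; a COHERENT tower of UNITARY one-step bonds in the
class `(L^{k+1})²b_k ≤ c`, `0 ≤ b_k`; the six polynomial smallness lines of file 8 on `c`; part 7's DISPLAYED regular presentation of the level bond fields
(`‖Rlev k − 1‖ ≤ ar_k`, `‖Rlev k(x,μ) − Rlev k(x−e_μ,μ)‖ ≤ ℓr_k`, `L^k ar_k ≤ α`, `(L^k)²ℓr_k ≤ λ`) with its two numeric lines `hsmallδ`, `hsmallQ`; free positive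
parameters `s, t, u, u₂, w : ℕ → ℝ`, `aa > 0`, `0 ≤ θ < 1`; and — DISPLAYED as the last four binders, about the EXPLICIT `let` sequences of file 8 with part 7's (GF3)
constants substituted — `v a k ≤ ⅛`, `γ k ≤ ¼`, `ε₁ a k ≤ c_ε θ^k`, `δ₁ a k ≤ c_δ θ^k` for every class sequence `a`.  CONCLUSION = part 6's verbatim: the effective
operators `effV (L^k) M (Rlev k) (GmProj …) (QmL (L^k) M (nestLv k)) aa` converge to a Hermitian limit with nonnegative form and the block-spin values converge.
HONEST, UP FRONT.  Compared with part 7 (gen 6) the (ONE-min) binder is GONE; compared with file 8 the (GF3) binder is GONE; what remains displayed beyond the class and the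
regular presentation is PURE ARITHMETIC on explicit sequences (supplier: leaf-10-g5's announced `VariationalColourTaxiTowerCentredDecay`, journal l.22515).  The numeric
thresholds are n-uniform and genuine but QUANTITATIVELY VOID (gen 6's erratum l.20174: `α ≲ 10⁻¹³ … 10⁻¹⁹`).  NOT Bałaban's (1.90) as printed; model level (c5).

HONEST FRAMING (T4-DAG p. 1).  Rung (B)+1 only — NOT infinite volume, NOT a mass gap, NOT Clay.  NE2 NOT IN PRINT, NOT proved here.  MODEL LEVEL (c5): bond operators DATA,
taxi contours, carriers, gauge fixing and competitor OURS; composition of landed leaves ([folklore]); nothing printed is a hypothesis; no `def`, no `def … : Prop`, no `sorry`;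
axioms standard.  V-END with background NOT proved unconditionally (the decay lines stay displayed); NE2 NOT proved; NE3 OPEN; spine PROVED 0∕9 unchanged.  HONEST
DEPENDENCY (cell, verbatim): continuum YM on T⁴ ⇐ BetaPertH ∧ nine spine estimates (0/9 proved); BetaPertH ⇐ (D1) ∧ (D4) ∧ CAP+tail; G-an2-4 gates asym, D1 and NE2/3/4.
-/

noncomputable section

namespace Summit.QuantumFields.BalabanUV.T4Continuum.VariationalColourTaxiTransport

open Filter
open scoped Matrix ComplexOrder BigOperators Topology
open Literature.MathematicalPhysics.QuantumFieldTheory.Balaban1983to89.B5Prop11Plancherel (Tor fine unitVec Cst)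
open Literature.Analysis.Complex (qform)
open Summit.QuantumFields.BalabanUV.T4Continuum.VariationalTransfer (blockSpin)
open Summit.QuantumFields.BalabanUV.T4Continuum.VariationalColourTower (Rtrv)
open Summit.QuantumFields.BalabanUV.T4Continuum.VariationalVectorFederbush (lineT)
open Summit.QuantumFields.BalabanUV.T4Continuum.VectorBlockTrialForm (nsqV QvL kappaV)
open Summit.QuantumFields.BalabanUV.T4Continuum.VariationalVectorForm (ScV SfV qWV lamV)
open Summit.QuantumFields.BalabanUV.T4Continuum.VariationalVectorEffective (unc effV)
open Summit.QuantumFields.BalabanUV.T4Continuum.VariationalVectorTower (QmL)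
open Summit.QuantumFields.BalabanUV.T4Continuum.VariationalVectorGaugeSlice (avgOp projG)
open Summit.QuantumFields.BalabanUV.T4Continuum.VariationalVectorRegularityCovariant (GmProj)
open Summit.QuantumFields.BalabanUV.T4Continuum.CovariantBlockReversePoincare (revPC)
open Summit.QuantumFields.BalabanUV.T4Continuum.SliceComplementFlatGap (deltaGap)

variable {d : ℕ}
variable (L : ℕ) [NeZero L] (M : Fin d → ℕ) [hM : ∀ μ, NeZero (M μ)]

/-- **EXISTENCE OF THE VECTOR TOWER LIMIT AT BAŁABAN's TAXI DATA FOR BAŁABAN's COVARIANT PROJECTED GAUGE FUNCTIONAL — (ONE-min) DISCHARGED, (GF3) SUPPLIED BY THE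
REGULAR PRESENTATION** (file 8 ∘ part 7): displayed are the class, part 7's regular presentation with its two numeric lines, and the four lines of class arithmetic on the
explicit sequences `v, γ, ε₁, δ₁` (part 7's (GF3) constants `36d(d+1)Cst_d(1)+8`, `24d(d+1)Cst_d(1)+4` substituted). [folklore] -/
theorem effV_tendsto_taxiTower_projG_centred_regular (hL : 2 ≤ L) (hd : 1 ≤ d) (hM2 : ∀ μ, 1 < M μ)
    {R' : (k : ℕ) → Tor (fine L (fine (L ^ k) M)) → Fin d → (ℂ →L[ℂ] ℂ)} (hU : ∀ k x μ, R' k x μ ∈ unitary (ℂ →L[ℂ] ℂ)) {b : ℕ → ℝ} {c : ℝ}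
    (hb : ∀ k x κ ι, ‖R' k x κ * R' k (x + unitVec (fine L (fine (L ^ k) M)) κ) ι - R' k x ι * R' k (x + unitVec (fine L (fine (L ^ k) M)) ι) κ‖ ≤ b k)
    (hb0 : ∀ k, 0 ≤ b k) (hbc : ∀ k, (((L ^ (k + 1) : ℕ)) : ℝ) ^ 2 * b k ≤ c)
    (hcoh : ∀ k, coarseTv L (fine (L ^ (k + 1)) M) (R' (k + 1)) = Rtrv (L ^ k) L M (R' k))
    -- the polynomial smallness of the class constant (part 2's four + two more)
    (hsm1 : 60 * (6 : ℝ) ^ (d - 1) * ((2 * ((((d - 1 : ℕ) : ℝ) + (d : ℝ) * d)) + 3 * ((d - 1 : ℕ) : ℝ)) * c) ≤ 1 / 2)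
    (hsm2 : 2 * (d : ℝ) * ((((d - 1 : ℕ) : ℝ)) * c) ^ 2 ≤ 1 / 2) (hsm3 : 64 * (2 * ((((d - 1 : ℕ) : ℝ) + (d : ℝ) * d) * c)) ^ 2 ≤ 1)
    (hsm4 : 80 * ((d : ℝ) * c) ≤ 1) (hsm5 : 64 * (d : ℝ) * ((((d - 1 : ℕ) : ℝ)) * c) ^ 2 ≤ 1 / 2)
    (hsm6 : 60 * (6 : ℝ) ^ (d - 1) * ((2 * ((((d - 1 : ℕ) : ℝ) + (d : ℝ) * d)) + 5 * ((d - 1 : ℕ) : ℝ)) * c) < 1)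
    -- the DISPLAYED regular presentation of the tower's unit-lattice bond fields and the two numeric lines replacing (GF3) (part 7's letters)
    {ar ℓr : ℕ → ℝ} {α lam : ℝ} (har0 : ∀ k, 0 ≤ ar k) (har : ∀ k x μ, ‖Rlev L M R' k x μ - 1‖ ≤ ar k)
    (hℓr : ∀ k x μ, ‖Rlev L M R' k x μ - Rlev L M R' k (x - unitVec (fine (L ^ k) M) μ) μ‖ ≤ ℓr k)
    (hα : ∀ k, (((L ^ k : ℕ)) : ℝ) * ar k ≤ α) (hlam : ∀ k, (((L ^ k : ℕ)) : ℝ) ^ 2 * ℓr k ≤ lam)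
    (hsmallδ : (18 * (d * ((d + 1 : ℝ) * Cst d 1)) + 6) * deltaGap d 1 α lam (d * α) (((d - 1 : ℕ) : ℝ) * c) ^ 2 ≤ 1 / 2)
    (hsmallQ : ((d + 1 : ℝ) * Cst d 1) * (7 * (d * α ^ 2) + 2 * (2 * ((((d - 1 : ℕ) : ℝ) + (d : ℝ) * d) * c) + (d * α + α)) ^ 2) ≤ 1 / 2)
    -- the effective-operator parameter, the decay rate, the free parameters
    {aa : ℝ} (haa : 0 < aa) {θ : ℝ} (hθ : 0 ≤ θ) (hθ1 : θ < 1)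
    (s t u u₂ w : ℕ → ℝ) (hs : ∀ k, 0 < s k) (ht : ∀ k, 0 < t k) (hu : ∀ k, 0 < u k) (hu₂ : ∀ k, 0 < u₂ k) (hw : ∀ k, 0 < w k) {cε cδ : ℝ} :
    -- the colour scalar pair's constants at the taxi frames (file 7's lets, `C_P = 136`)
    let Λc : (ℕ → ℝ) → ℕ → ℝ := fun a k => 2 * d * (36 : ℝ) ^ d * ((1 + ((L ^ k : ℕ) : ℝ) * (((d - 1 : ℕ) : ℝ) * ((L ^ k - 1 : ℕ) : ℝ) * a k)) ^ 2 + 9)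
    let CRc : (ℕ → ℝ) → ℕ → ℝ := fun a k => 2 * Λc a k + 2 * d * (a k * (((L ^ k : ℕ) : ℝ)) ^ 2) + (d : ℝ) ^ 2 * (a k * (((L ^ k : ℕ) : ℝ)) ^ 2) ^ 2 * 136
    let ε₁c : ℕ → ℝ := fun k => ((d : ℝ) / 4 + 1 / 2) * ((L : ℝ) / (((L ^ k : ℕ) : ℝ)) ^ 2)
    let δ'c : ℕ → ℝ := fun k => Real.sqrt (2 * d * (1 + (d : ℝ) ^ 2)) * ((((L ^ k : ℕ) : ℝ)) * L * (((d - 1 : ℕ) : ℝ) * ((L - 1 : ℕ) : ℝ) * ((2 * L - 1 : ℕ) : ℝ) * b k))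
    let Λcol : (ℕ → ℝ) → ℕ → ℝ := fun a k => Λc a k + (ε₁c k * CRc a k + 2 * δ'c k * Real.sqrt ((1 + ε₁c k * CRc a k) * 136) + δ'c k ^ 2 * 136) * (Λc a k + 1)
    -- part 6 §1's V-P ∕ (Går) constants from part 7's (GF3) constants `36d(d+1)Cst+8`, `24d(d+1)Cst+4`, file 5's `Λᵥ`, part 8's V-REG constant
    let CPv : (ℕ → ℝ) → ℕ → ℝ := fun a k => max (40 * (2 * (1 + (36 * (d * ((d + 1 : ℝ) * Cst d 1)) + 8)))) (64 + 40 * (2 * ((24 * (d * ((d + 1 : ℝ) * Cst d 1)) + 4) + d * ((((L ^ k : ℕ) : ℝ)) ^ 2 * a k) * 64)))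
    let CGar' : (ℕ → ℝ) → ℕ → ℝ := fun a k => 2 * ((24 * (d * ((d + 1 : ℝ) * Cst d 1)) + 4) + d * ((((L ^ k : ℕ) : ℝ)) ^ 2 * a k) * 64)
    let Λv : (ℕ → ℝ) → ℕ → ℝ := fun a k => lamV d ((L ^ k * L : ℕ) * (((d - 1 : ℕ) : ℝ) * ((L - 1 : ℕ) : ℝ) * ((2 * L - 1 : ℕ) : ℝ) * b k + ((d - 1 : ℕ) : ℝ) * ((L ^ k - 1 : ℕ) : ℝ) * a k)) d (((L ^ k * L : ℕ) : ℝ) ^ 2 * 0)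
          / (1 - (kappaV d (L ^ k * L))⁻¹ * ((∑ q ∈ Finset.range k, ((((d - 1 : ℕ) : ℝ) + (d : ℝ) * d) * (((L : ℝ) * ((L ^ q - 1 : ℕ) : ℝ) * ((L - 1 : ℕ) : ℝ)) * b q))) + 3 * (((d - 1 : ℕ) : ℝ) * (L ^ k : ℕ) * ((L ^ k - 1 : ℕ) : ℝ) * a k) + ((d - 1 : ℕ) : ℝ) * ((L ^ k - 1 : ℕ) : ℝ) * ((2 * L ^ k - 1 : ℕ) : ℝ) * a k)) ^ 2
    let CRv : ℝ := (8 * (4 * lamV d (((d - 1 : ℕ) : ℝ) * c) (d : ℝ) 0) + 2 * d * c * ((2 * (1 + (36 * (d * ((d + 1 : ℝ) * Cst d 1)) + 8))) + (2 * ((24 * (d * ((d + 1 : ℝ) * Cst d 1)) + 4) + (d : ℝ) * c * 64))) + (8 * (4 * d * 36 ^ d * (1 + ((d - 1 : ℕ) : ℝ) * c) ^ 2) ^ 2 + 5 * (d : ℝ) ^ 2 * c ^ 2) * (max (40 * (2 * (1 + (36 * (d * ((d + 1 : ℝ) * Cst d 1)) + 8)))) (64 + 40 * (2 * ((24 * (d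 * ((d + 1 : ℝ) * Cst d 1)) + 4) + (d : ℝ) * c * 64)))))
    -- leaf-01-g9's `eH`, `e₂`, `ε⋆` at the taxi sizes, and `δ′`
    let eH : (ℕ → ℝ) → ℕ → ℝ := fun a k => (((d : ℝ) / 4 + 1 / 2) * ((L : ℝ) / ((L ^ k : ℕ) : ℝ) ^ 2)) * CRc a k * (Λcol a k + 1)
        + 2 * (Real.sqrt (2 * d * (1 + (d : ℝ) ^ 2)) * (((L ^ k : ℕ) : ℝ) * L * (((d - 1 : ℕ) : ℝ) * ((L - 1 : ℕ) : ℝ) * ((2 * L - 1 : ℕ) : ℝ) * b k)))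
          * Real.sqrt ((Λcol a k + (((d : ℝ) / 4 + 1 / 2) * ((L : ℝ) / ((L ^ k : ℕ) : ℝ) ^ 2)) * CRc a k * (Λcol a k + 1)) * (136 * (Λcol a k + 1)))
        + (Real.sqrt (2 * d * (1 + (d : ℝ) ^ 2)) * (((L ^ k : ℕ) : ℝ) * L * (((d - 1 : ℕ) : ℝ) * ((L - 1 : ℕ) : ℝ) * ((2 * L - 1 : ℕ) : ℝ) * b k))) ^ 2 * (136 * (Λcol a k + 1))
        + 2 * (Real.sqrt d * (((L ^ k : ℕ) : ℝ) * (((d - 1 : ℕ) : ℝ) * L * ((L - 1 : ℕ) : ℝ) * b k))) * Real.sqrt (Λcol a k * (136 * (Λcol a k + 1)))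
    let e₂ : (ℕ → ℝ) → ℕ → ℝ := fun a k => t k + 3 * (1 + (t k)⁻¹) * (8 * d * ((((L ^ k : ℕ) : ℝ) ^ 2)⁻¹ * CRv
          + (1 + (((d - 1 : ℕ) : ℝ) * ((L - 1 : ℕ) : ℝ) * ((2 * L - 1 : ℕ) : ℝ) * b k)) ^ 2 * ((d : ℝ) / 4 * L * ((((L ^ k : ℕ) : ℝ) ^ 2)⁻¹ * CRv)) + (((d - 1 : ℕ) : ℝ) * ((L - 1 : ℕ) : ℝ) * ((2 * L - 1 : ℕ) : ℝ) * b k) ^ 2 * ((2 * (1 + (36 * (d * ((d + 1 : ℝ) * Cst d 1)) + 8))) + CGar' a k)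
          + (((d - 1 : ℕ) : ℝ) * ((L - 1 : ℕ) : ℝ) * ((2 * L - 1 : ℕ) : ℝ) * b k) ^ 2 * (2 * (1 + (d : ℝ) ^ 2) * (L : ℝ) ^ 2 * (((L ^ k : ℕ) : ℝ) ^ 2 * CPv a k)))
        + (d : ℝ) / 2 * (2 * d * ((((L ^ k : ℕ) : ℝ) ^ 2)⁻¹ * CRv) + 2 * (d : ℝ) ^ 2 * a k ^ 2 * (((L ^ k : ℕ) : ℝ) ^ 2 * CPv a k))
        + (d : ℝ) / 4 * (2 * (2 * d * ((((L ^ k : ℕ) : ℝ) ^ 2)⁻¹ * CRv) + 2 * (d : ℝ) ^ 2 * a k ^ 2 * (((L ^ k : ℕ) : ℝ) ^ 2 * CPv a k)) + 2 * (Λcol a k * (((L ^ k : ℕ) : ℝ) ^ 2)⁻¹ * ((36 * (d * ((d + 1 : ℝ) * Cst d 1)) + 8) + (24 * (d * ((d + 1 : ℝ) * Cst d 1)) + 4))))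
        + 136 * eH a k * ((36 * (d * ((d + 1 : ℝ) * Cst d 1)) + 8) + (24 * (d * ((d + 1 : ℝ) * Cst d 1)) + 4)))
    let εs : (ℕ → ℝ) → ℕ → ℝ := fun a k => u k + (1 + u k) * ((s k + (1 + (s k)⁻¹) * (d * (L : ℝ) / ((L ^ k : ℕ) : ℝ) ^ 2)) * (1 + CRv) + e₂ a k)
      + (1 + (u k)⁻¹) * (Λv a k * (25 / 4 * ((((L ^ k : ℕ) : ℝ) ^ 2)⁻¹ * ((2 * (1 + (36 * (d * ((d + 1 : ℝ) * Cst d 1)) + 8))) + CGar' a k))))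
    let δ' : ℕ → ℝ := fun k => Real.sqrt (8 * d * (1 + (d : ℝ) ^ 2)) * (((L ^ k : ℕ) : ℝ) * L * (((d - 1 : ℕ) : ℝ) * ((L - 1 : ℕ) : ℝ) * ((2 * L - 1 : ℕ) : ℝ) * b k))
    -- file 4b's transfer constants
    let v : (ℕ → ℝ) → ℕ → ℝ := fun a k => (1 + (u₂ k)⁻¹) * (4 * ((d : ℝ) * ((d : ℝ) * (((L : ℝ) * ((L ^ k - 1 : ℕ) : ℝ) * ((L - 1 : ℕ) : ℝ)) * b k)))
          * revPC d (L ^ k * L) (((d - 1 : ℕ) : ℝ) * ((L - 1 : ℕ) : ℝ) * ((2 * L - 1 : ℕ) : ℝ) * b k + ((d - 1 : ℕ) : ℝ) * ((L ^ k - 1 : ℕ) : ℝ) * a k)) ^ 2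
        * ((d : ℝ) * ((2 * (1 + (36 * (d * ((d + 1 : ℝ) * Cst d 1)) + 8))) + (2 * ((24 * (d * ((d + 1 : ℝ) * Cst d 1)) + 4) + d * ((((L ^ (k + 1) : ℕ) : ℝ)) ^ 2 * b k) * 64))))
    let γ : ℕ → ℝ := fun k => (3 * (((d - 1 : ℕ) : ℝ) * L * ((L - 1 : ℕ) : ℝ) * b k)) ^ 2 * max (40 * (2 * (1 + (36 * (d * ((d + 1 : ℝ) * Cst d 1)) + 8)))) (64 + 40 * (2 * ((24 * (d * ((d + 1 : ℝ) * Cst d 1)) + 4) + d * ((((L ^ (k + 1) : ℕ) : ℝ)) ^ 2 * b k) * 64)))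
    let Λf : ℕ → ℝ := fun k => lamV d ((L ^ (k + 1) : ℕ) * (((d - 1 : ℕ) : ℝ) * ((L ^ (k + 1) - 1 : ℕ) : ℝ) * b k)) d (((L ^ (k + 1) : ℕ) : ℝ) ^ 2 * 0)
          / (1 - (kappaV d (L ^ (k + 1)))⁻¹ * ((∑ q ∈ Finset.range (k + 1), ((((d - 1 : ℕ) : ℝ) + (d : ℝ) * d) * (((L : ℝ) * ((L ^ q - 1 : ℕ) : ℝ) * ((L - 1 : ℕ) : ℝ)) * b q)))
              + 3 * (((d - 1 : ℕ) : ℝ) * (L ^ (k + 1) : ℕ) * ((L ^ (k + 1) - 1 : ℕ) : ℝ) * b k))) ^ 2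
    let A : (ℕ → ℝ) → ℕ → ℝ := fun a k => (1 + w k + (1 + (w k)⁻¹) * (Λf k * γ k) * (1 + 4 * γ k)) * (1 + 4 * v a k) * (1 + u₂ k)
    let B : (ℕ → ℝ) → ℕ → ℝ := fun a k => (1 + w k + (1 + (w k)⁻¹) * (Λf k * γ k) * (1 + 4 * γ k)) * (1 + 4 * v a k) * (4 * v a k) + 4 * ((1 + (w k)⁻¹) * (Λf k * γ k))
    -- the END's decaying defects
    let ε₁ : (ℕ → ℝ) → ℕ → ℝ := fun a k => (A a k - 1) + A a k * εs a k + B a k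
    let δ₁ : (ℕ → ℝ) → ℕ → ℝ := fun a k => Real.sqrt (A a k) * δ' k
    -- the DISPLAYED arithmetic on the explicit sequences, for every class sequence `a`
    (∀ a : ℕ → ℝ, (∀ k, 0 ≤ a k) → (∀ k, (((L ^ k : ℕ)) : ℝ) ^ 2 * a k ≤ c) → ∀ k, v a k ≤ 1 / 8) →
    (∀ k, γ k ≤ 1 / 4) →
    (∀ a : ℕ → ℝ, (∀ k, 0 ≤ a k) → (∀ k, (((L ^ k : ℕ)) : ℝ) ^ 2 * a k ≤ c) → ∀ k, ε₁ a k ≤ cε * θ ^ k) →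
    (∀ a : ℕ → ℝ, (∀ k, 0 ≤ a k) → (∀ k, (((L ^ k : ℕ)) : ℝ) ^ 2 * a k ≤ c) → ∀ k, δ₁ a k ≤ cδ * θ ^ k) →
    ∃ Xlim : Matrix (Tor M × Fin d) (Tor M × Fin d) ℂ,
      Tendsto (fun k => effV (L ^ k) M (Rlev L M R' k)
        (GmProj (fine (L ^ k) M) (Rlev L M R' k) (LinearMap.ker (avgOp (L ^ k) M (taxiTv (L ^ k) M (Rlev L M R' k))))) (QmL (L ^ k) M (nestLv L M R' k)) aa)
        atTop (𝓝 Xlim) ∧ Xlim.IsHermitian ∧ (∀ v, 0 ≤ qform Xlim v) ∧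
      ∀ φ : Tor M → Fin d → ℂ, Tendsto (fun k => blockSpin (QvL (L ^ k) M (nestLv L M R' k))
        (ScV (L ^ k) M (Rlev L M R' k) (projG (fine (L ^ k) M) (Rlev L M R' k) (LinearMap.ker (avgOp (L ^ k) M (taxiTv (L ^ k) M (Rlev L M R' k)))))) φ)
        atTop (𝓝 (qform Xlim (unc φ))) := by
  intro Λc CRc ε₁c δ'c Λcol CPv CGar' Λv CRv eH e₂ εs δ' v γ Λf A B ε₁ δ₁ hv hγ hεθ hδθ
  -- part 7's (GF3) constants are nonnegative (`1 ≤ Cst d 1`)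
  have hC1 : (1 : ℝ) ≤ Cst d 1 := Literature.MathematicalPhysics.QuantumFieldTheory.Balaban1983to89.B5Prop11Lower.one_le_Cst (d := d) (1 : ℝ)
  have hC0 : (0 : ℝ) ≤ d * ((d + 1 : ℝ) * Cst d 1) :=
    mul_nonneg (Nat.cast_nonneg d) (mul_nonneg (by exact_mod_cast Nat.zero_le (d + 1)) (zero_le_one.trans hC1))
  have hCf0 : (0 : ℝ) ≤ 36 * (d * ((d + 1 : ℝ) * Cst d 1)) + 8 := add_nonneg (mul_nonneg (by norm_num : (0 : ℝ) ≤ 36) hC0) (by norm_num : (0 : ℝ) ≤ 8)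
  have hCf0' : (0 : ℝ) ≤ 24 * (d * ((d + 1 : ℝ) * Cst d 1)) + 4 := add_nonneg (mul_nonneg (by norm_num : (0 : ℝ) ≤ 24) hC0) (by norm_num : (0 : ℝ) ≤ 4)
  -- a plaquette class sequence of the level bond fields (part 4's package; only its first three lines are used)
  obtain ⟨p, hp0, hp, hpc, -, -, -, -, -⟩ := taxiClassPackage L M hL hd hU hb hbc hsm1 hsm2 hsm3 (CG := fun _ => (d : ℝ)) (C₀ := fun _ => 0)
    (CGs := (d : ℝ)) (c₀ := 0) (fun _ => Nat.cast_nonneg d) (fun _ => le_rfl) (fun _ => le_rfl) (fun _ => by simp)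
  -- file 8 with (GF3) := part 7's `hGdiv_projG_nestLv_regular`
  exact effV_tendsto_taxiTower_projG_centred L M hL hd hM2 hU hb hb0 hbc hcoh hsm1 hsm2 hsm3 hsm4 hsm5 hsm6
    (CDs := 36 * (d * ((d + 1 : ℝ) * Cst d 1)) + 8) (CDs' := 24 * (d * ((d + 1 : ℝ) * Cst d 1)) + 4) hCf0 hCf0'
    (fun k W => hGdiv_projG_nestLv_regular L M hL hU hb hbc hcoh hd hM2 k (hp0 k) (hp k) (hpc k) (har0 k) (har k) (hℓr k) (hα k) (hlam k) hsmallδ hsmallQ W)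
    haa hθ hθ1 s t u u₂ w hs ht hu hu₂ hw hv hγ hεθ hδθ

end Summit.QuantumFields.BalabanUV.T4Continuum.VariationalColourTaxiTransport

end
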